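import Literature.NumberTheory.EllipticCurves.PAdicLFunction
import HarnessLib

/-!
# The Mazur–Swinnerton-Dyer / Mazur–Tate–Teitelbaum plus measure at a TAME LEVEL `m` and the
# `χ`-twisted cyclotomic `p`-adic `L`-function `L_p(f, α, χ, T)` (Dirichlet character `χ` mod `m`,
# `(m, p) = 1`) — DEFINITIONS ONLY (every `def` has a body; nothing asserted, no named fact)

Companion of `Literature.NumberTheory.EllipticCurves.PAdicLFunction` (item C19: the level-`1` measure
`msdMeasure f α n a = μ_{f,α}(a + pⁿℤ_p)` and `padicLFunction f α = ∫_{ℤ_pˣ} (1+T)^{ℓ(x)} dμ_{f,α}`), which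
covers only the trivial tame character. Mazur–Tate–Teitelbaum construct the measure on
`ℤ_{p,M}^× = lim (ℤ/pⁿM)^×` for an auxiliary ("tame") modulus `M` prime to `p` (§I.10: "Fix an integer
`M > 0` prime to `p`", display (10.1) `μ_{f,α}(a + pⁿM ℤ_{p,M}) = α⁻ⁿ Φ(a/(pⁿM)) − ε(p) α⁻⁽ⁿ⁺¹⁾ Φ(a/(pⁿ⁻¹M))`)
and the `χ`-twisted `p`-adic `L`-function for a Dirichlet character `χ` of conductor `M` or `pⁿM`
(§I.13–I.14); K. Matsuno (J. Number Theory 84 (2000), §2 p. 83) writes the same objects `μ_{E,m}`,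
`G_{p,m}(E, φ, T) = ∫ φ(x)(1+T)^{t(x)} dμ_{E,m}`. This file TYPES them over the tree's rational plus symbol
`[r]⁺_f = ratPlusSymbol f r` (hence, like `padicLFunction`, for EVEN characters / the plus measure), in the
tree's normalisation (periods `Ω⁺_f`, variable `1 + T ↔ γ = cyclotomicGenerator p`, `ℓ(x)` the normalised
logarithm, sum over ALL of `ℤ_pˣ` incl. the torsion):

* `tameRep p m n a b ∈ ℕ`, `tameFraction p m n a b = tameRep/(pⁿm) ∈ ℚ` — the Chinese-remainder
  representative `c = (a·m⁻¹ mod pⁿ)·m + (b·(pⁿ)⁻¹ mod m)·pⁿ` of the class `(a mod pⁿ, b mod m)` and its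
  fraction `c/(pⁿm)` (`ZMod` inverses; for `(m, p) = 1` one has `c ≡ a (pⁿ)`, `c ≡ b (m)`; only the class
  of the fraction mod `ℤ` matters, `[r + 1]⁺ = [r]⁺`).
* `msdMeasureTame f m α n a b = μ_{f,α,m}((a + pⁿℤ_p) × {b}) = α⁻ⁿ [c/(pⁿm)]⁺_f − α⁻⁽ⁿ⁺¹⁾ [c/(pⁿ⁻¹m)]⁺_f`
  (`a : ZMod (p ^ n)`, `b : ZMod m`; MTT (10.1) with trivial Nebentypus, written UNIFORMLY in `n` — at
  `n = 0` it is `[b/m]⁺ − α⁻¹[p b/m]⁺`, the value forced by the distribution relation, and at `m = 1` it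
  agrees with `msdMeasure f α n a`: `(1 − α⁻¹)[0]⁺` for `n = 0`, `α⁻ⁿ[a/pⁿ]⁺ − α⁻⁽ⁿ⁺¹⁾[a/pⁿ⁻¹]⁺` else).
* `padicLRiemannSumTame f m α χ k n`, `padicLCoeffTame f m α χ k`, **`padicLFunctionTame f m α χ`** — the
  Riemann sums `∑_η ∑_{s mod pⁿ} ∑_{b mod m} χ(b) μ_{f,α,m}((η γˢ + p^{n+e₀}ℤ_p) × {b}) · (s choose k)`, their
  limits, and `L_p(f, α, χ, T) = ∫_{ℤ_pˣ × ℤ/m} χ(x_m) (1+T)^{ℓ(x_p)} dμ_{f,α,m}` (MTT §I.13 with a tame character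
  = Matsuno's `G_{p,m}(E, χ, T)` up to his period-lattice normalisation and, at `p = 2`, the factor `2`
  of the torsion `{±1}`: the tree integrates the HALVED plus symbol over all of `ℤ₂ˣ`, cf.
  `PAdicLFunctionIntegralityAtTwoProofs` §1–§3), for a Dirichlet character `χ` mod `m` WITH VALUES IN `ℚ_p`
  (the quadratic characters `χ_d` and the characters of order dividing `p − 1`;
  -- TODO(general form): values in `ℤ_p[χ] ⊂ ℂ_p` (MTT §I.13, Matsuno §2) and a Nebentypus `ε(p)`).
  `χ(b) = 0` off the units, so the sum runs over `ℤ_{p,m}^×`; `χ = 𝟙_m` (trivial character mod `m`) gives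
  the `m`-DEPLETED function, `χ = χ_d` (conductor `m = d`) the function whose Birch transform is
  `L_p(f ⊗ χ_d, χ_d(p) α, T)`.

ANCHOR at `m = 1` (kernel lemmas of this file): `tameRep p 1 n a b = a.val`, `msdMeasureTame f 1 α n a b =
msdMeasure f α n a`, `padicLRiemannSumTame f 1 α 1 = padicLRiemannSum f α`, `padicLFunctionTame f 1 α 1 =
padicLFunction f α` — the SAME Riemann sums, so the tree's normalisation (halved plus symbol over all of `ℤ_pˣ`,
i.e. at `p = 2` the transform over `1 + 4ℤ₂` of the integral plus measure) is inherited verbatim.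
NAMED FACTS (`def … : Prop`, D-0014; TO BE PROVED in the companion `PAdicLFunctionTameProofs` — the
level-change identity is already kernel-checked in prototype form against these definitions, cell bsd-2adic
HOME/conv1-g11/drafts/TameLevelChangeProto.lean, farm rc 0 — and never to be displayed as binders):
`msdMeasureTame_distribution` (the distribution relation in the `p`-direction, MTT §I.10 (10.2), from the
Hecke relation at `p`), `msdMeasureTame_levelChange` (the tame level-change identity behind Matsuno 2000
Lemma 2.2 = Mazur–Swinnerton-Dyer 1974 §8 Lemma 2, `∑_{b'↦b} μ_{mℓ} = a_ℓ μ_m − μ_m(ℓ·)`, from the Hecke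
relation `intCast_mul_ratPlusSymbol` at the good prime `ℓ`), `tendsto_padicLRiemannSumTame` (boundedness
and convergence for a unit root, MTT §I.11–13). CONSUMER: cell
bsd-2adic, seat conv-1 roadmap «kernelise hKan» — the analytic Kida formula at `p = 2` for real quadratic
twists reduces (`Summits/…/Theorems/TwoAdicConverseKidaAnalyticOfCongruence.lean`) to the congruence
`L_2(f_{E^{(d)}}) ≡ v·L_2(f_E)·∏_{ℓ∣d}𝒫_ℓ (mod 2Λ)`, i.e. Matsuno 2000 Lemma 3.2 (`L_p(f,α,χ_d) ≡ L_p(f,α,𝟙_d)`)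
+ Lemma 3.3 (`L_p(f,α,𝟙_{mℓ}) = h_ℓ · L_p(f,α,𝟙_m)`) for THESE objects.

References: B. Mazur, J. Tate, J. Teitelbaum, Invent. Math. 84 (1986), §I.10 (10.1)–(10.2), §I.13, §I.14
[MazurTateTeitelbaum1986Invent]; B. Mazur, P. Swinnerton-Dyer, Invent. Math. 25 (1974), §8
[MazurSwinnertonDyer1974Invent]; K. Matsuno, J. Number Theory 84 (2000), §2 (pp. 82–85), Lemma 2.2
[Matsuno2000].
-/

noncomputable section

open scoped MatrixGroups ModularForm

open CongruenceSubgroup Filter Topology Literature.NumberTheory.EllipticCurves.ModularForms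

namespace Literature.NumberTheory.EllipticCurves

/-! ### The Chinese-remainder representative and the tame fraction -/

section TameFraction

variable (p m : ℕ)

/-- The **Chinese-remainder representative** `c ∈ ℕ` of the class `(a mod pⁿ, b mod m)`:
`c = (a·m⁻¹ mod pⁿ)·m + (b·(pⁿ)⁻¹ mod m)·pⁿ` (`ZMod` inverses, representatives `val ∈ [0, ·)`); for
`(m, p) = 1`, `c ≡ a (mod pⁿ)` and `c ≡ b (mod m)` (kernel lemmas of the proofs file); junk but harmless
otherwise (the inverses are then `0`). [folklore] -/
def tameRep (n : ℕ) (a : ZMod (p ^ n)) (b : ZMod m) : ℕ :=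
  (a * (m : ZMod (p ^ n))⁻¹).val * m + (b * ((p : ZMod m) ^ n)⁻¹).val * p ^ n

/-- The **tame fraction** `c/(pⁿm) ∈ ℚ` of the class `(a mod pⁿ, b mod m)`, `c = tameRep p m n a b`
(`= a·(m⁻¹ mod pⁿ)/pⁿ + b·((pⁿ)⁻¹ mod m)/m`); the argument of the modular symbol `[c/(pⁿm)]⁺_f` in
Mazur–Tate–Teitelbaum's (10.1) at tame level `m`. [cite: MazurTateTeitelbaum1986Invent, §I.10 (10.1) (pp. 12–13)] -/
def tameFraction (n : ℕ) (a : ZMod (p ^ n)) (b : ZMod m) : ℚ :=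
  (tameRep p m n a b : ℚ) / ((p : ℚ) ^ n * m)

end TameFraction

/-! ### The Mazur–Swinnerton-Dyer measure at tame level `m` -/

section Measure

variable {N : ℕ} (f : CuspForm (Gamma0 N) 2) {p : ℕ} [Fact p.Prime] (m : ℕ)

/-- The **Mazur–Swinnerton-Dyer / Mazur–Tate–Teitelbaum plus measure at tame level `m`**,
`μ_{f,α,m}((a + pⁿℤ_p) × {b}) = α⁻ⁿ [c/(pⁿm)]⁺_f − α⁻⁽ⁿ⁺¹⁾ [c/(pⁿ⁻¹m)]⁺_f` for `a : ZMod (p ^ n)`,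
`b : ZMod m`, `c = tameRep p m n a b` the Chinese-remainder representative, `c/(pⁿ⁻¹m) = p · c/(pⁿm)`
(Mazur–Tate–Teitelbaum §I.10 (10.1) with trivial Nebentypus, `Φ ↦ [·]⁺_f = ratPlusSymbol f`, cast
`ℚ → ℚ_p`; Matsuno 2000 §2 `μ_{E,m}`). Written uniformly in `n`: at `n = 0` (the set `ℤ_p × {b}`) the
formula reads `[b/m]⁺ − α⁻¹[p·b/m]⁺`, the value forced by the distribution relation, and at `m = 1` it
agrees with `msdMeasure f α` (`(1 − α⁻¹)[0]⁺` for `n = 0`). Junk (harmless) for `α = 0` or `(m, p) ≠ 1`.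
[cite: MazurTateTeitelbaum1986Invent, §I.10 (10.1) (pp. 12–13)] [cite: Matsuno2000, §2 (p. 83, the measure μ_{E,m})] -/
def msdMeasureTame (α : ℚ_[p]) (n : ℕ) (a : ZMod (p ^ n)) (b : ZMod m) : ℚ_[p] :=
  α⁻¹ ^ n * (ratPlusSymbol f (tameFraction p m n a b) : ℚ_[p]) -
    α⁻¹ ^ (n + 1) * (ratPlusSymbol f ((p : ℚ) * tameFraction p m n a b) : ℚ_[p])

/-! #### Anchor at `m = 1`: the level-`1` objects of `PAdicLFunction` -/

omit [Fact p.Prime] in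
/-- At tame level `m = 1` the Chinese-remainder representative of `(a, ·)` is `a.val`.
[cite: MazurTateTeitelbaum1986Invent, §I.10 (10.1) (pp. 12–13)] -/
theorem tameRep_one (n : ℕ) (a : ZMod (p ^ n)) (b : ZMod 1) : tameRep p 1 n a b = a.val := by
  have h1 : ((1 : ℕ) : ZMod (p ^ n))⁻¹ = 1 := by
    rw [Nat.cast_one]
    have h := ZMod.mul_inv_of_unit (1 : ZMod (p ^ n)) isUnit_one
    rwa [one_mul] at h
  have hb : (b * ((p : ZMod 1) ^ n)⁻¹).val = 0 := by
    rw [Subsingleton.elim (b * ((p : ZMod 1) ^ n)⁻¹) 0, ZMod.val_zero]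
  rw [tameRep, h1, mul_one, mul_one, hb, zero_mul, add_zero]

omit [Fact p.Prime] in
/-- At tame level `m = 1` the tame fraction of `(a, ·)` is `a/pⁿ`.
[cite: MazurTateTeitelbaum1986Invent, §I.10 (10.1) (pp. 12–13)] -/
theorem tameFraction_one (n : ℕ) (a : ZMod (p ^ n)) (b : ZMod 1) :
    tameFraction p 1 n a b = (a.val : ℚ) / (p : ℚ) ^ n := by
  rw [tameFraction, tameRep_one, Nat.cast_one, mul_one]

/-- **Anchor**: at tame level `m = 1` the tame measure IS the level-`1` measure of `PAdicLFunction`,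
`msdMeasureTame f 1 α n a b = msdMeasure f α n a` (both cases of `msdMeasure`'s definition).
[cite: MazurTateTeitelbaum1986Invent, §I.10 (10.1) (pp. 12–13)] -/
theorem msdMeasureTame_one (α : ℚ_[p]) (n : ℕ) (a : ZMod (p ^ n)) (b : ZMod 1) :
    msdMeasureTame f 1 α n a b = msdMeasure f α n a := by
  have hp0 : (p : ℚ) ≠ 0 := by exact_mod_cast (Fact.out : p.Prime).ne_zero
  rw [msdMeasureTame, tameFraction_one]
  cases n with
  | zero =>
    have ha : a.val = 0 := by
      haveI : Subsingleton (ZMod (p ^ 0)) := (ZMod.subsingleton_iff).mpr (pow_zero p)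
      rw [Subsingleton.elim a 0, ZMod.val_zero]
    simp only [msdMeasure, ha, Nat.cast_zero, zero_div, mul_zero, pow_zero, one_mul]
    ring
  | succ n =>
    have h : (p : ℚ) * ((a.val : ℚ) / (p : ℚ) ^ (n + 1)) = (a.val : ℚ) / (p : ℚ) ^ n := by
      field_simp
      ring
    simp only [msdMeasure, h]

end Measure

/-! ### The `χ`-twisted `p`-adic `L`-function at tame level `m` -/

section LFunction

variable {N : ℕ} (f : CuspForm (Gamma0 N) 2) {p : ℕ} [Fact p.Prime] (m : ℕ) [NeZero m]

/-- The `n`-th **Riemann sum** for the `k`-th coefficient of `L_p(f, α, χ, T)` at tame level `m`: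
`∑_η ∑_{s mod pⁿ} ∑_{b mod m} χ(b) · μ_{f,α,m}((η γˢ + p^{n+e₀}ℤ_p) × {b}) · (s choose k)`, `η` over the
torsion of `ℤ_pˣ`, `γ = 1 + p^{e₀}` — the level-`m` analogue of `padicLRiemannSum` (the case `m = 1`,
`χ = 1`), a Riemann sum for `∫_{ℤ_pˣ × ℤ/m} χ(x_m) (ℓ(x_p) choose k) dμ_{f,α,m}`; `χ(b) = 0` for `b` not a unit,
so effectively over `ℤ_{p,m}^×`. `χ` has values in `ℚ_p`. [cite: MazurTateTeitelbaum1986Invent, §I.13 (pp. 18–19)] -/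
def padicLRiemannSumTame (α : ℚ_[p]) (χ : DirichletCharacter ℚ_[p] m) (k n : ℕ) : ℚ_[p] :=
  ∑ᶠ η : rootsOfUnity (torsionOrder p) ℤ_[p], ∑ s : ZMod (p ^ n), ∑ b : ZMod m,
    χ b *
      msdMeasureTame f m α (n + cyclotomicExponent p)
          (PadicInt.toZModPow (n + cyclotomicExponent p) ((η : ℤ_[p]ˣ) : ℤ_[p]) *
            (cyclotomicGenerator p : ZMod (p ^ (n + cyclotomicExponent p))) ^ s.val) b *
      (s.val.choose k : ℚ_[p])

/-- The `k`-th **coefficient** of `L_p(f, α, χ, T)` at tame level `m`: `lim_n padicLRiemannSumTame f m α χ k n`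
(junk value of `limUnder` off the convergent case — `α` the unit root, where the measure is bounded).
[cite: MazurTateTeitelbaum1986Invent, §I.11–I.13 (pp. 13–19)] -/
def padicLCoeffTame (α : ℚ_[p]) (χ : DirichletCharacter ℚ_[p] m) (k : ℕ) : ℚ_[p] :=
  limUnder atTop (padicLRiemannSumTame f m α χ k)

/-- The **`χ`-twisted `p`-adic `L`-function at tame level `m`**:
`L_p(f, α, χ, T) = ∫_{ℤ_pˣ × ℤ/m} χ(x_m) (1 + T)^{ℓ(x_p)} dμ_{f,α,m} ∈ ℚ_p⟦T⟧` (Mazur–Tate–Teitelbaum §I.13 with a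
tame character; Matsuno's `G_{p,m}(E, χ, T)`, §2 p. 83, up to his period-lattice normalisation and, at
`p = 2`, the factor `2` of the torsion `{±1}`). For `m = 1`, `χ = 1` this is `padicLFunction f α`
(same Riemann sums); for `χ = 𝟙_m` it is the `m`-DEPLETED function; for `χ = χ_d` quadratic of conductor
`m = d` the function whose Birch transform is `L_p(f ⊗ χ_d, χ_d(p)α, T)`.
[cite: MazurTateTeitelbaum1986Invent, §I.13 (pp. 18–19)] [cite: Matsuno2000, §2 (p. 83, definition of G_{p,m}(E, φ, T))] -/
def padicLFunctionTame (α : ℚ_[p]) (χ : DirichletCharacter ℚ_[p] m) : PowerSeries ℚ_[p] :=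
  PowerSeries.mk (padicLCoeffTame f m α χ)

/-- The `k`-th coefficient of `L_p(f, α, χ, T) = ∑_k c_k T^k` is `c_k = padicLCoeffTame f m α χ k` (unfolding of the
definition, Mazur–Tate–Teitelbaum §I.13). [cite: MazurTateTeitelbaum1986Invent, §I.13 (pp. 18–19)] -/
theorem coeff_padicLFunctionTame (α : ℚ_[p]) (χ : DirichletCharacter ℚ_[p] m) (k : ℕ) :
    PowerSeries.coeff k (padicLFunctionTame f m α χ) = padicLCoeffTame f m α χ k :=
  PowerSeries.coeff_mk _ _

end LFunction

/-! #### Anchor at `m = 1`, `χ = 1`: the `p`-adic `L`-function of `PAdicLFunction` -/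

section Anchor

variable {N : ℕ} (f : CuspForm (Gamma0 N) 2) {p : ℕ} [Fact p.Prime]

/-- **Anchor**: at `m = 1`, `χ = 1` the tame Riemann sums ARE the Riemann sums of `padicLFunction f α`
(`χ(0) = 1` in the zero ring `ℤ/1`, where `0 = 1` is a unit; `msdMeasureTame_one`).
[cite: MazurTateTeitelbaum1986Invent, §I.13 (pp. 18–19)] -/
theorem padicLRiemannSumTame_one (α : ℚ_[p]) (k n : ℕ) :
    padicLRiemannSumTame f 1 α (1 : DirichletCharacter ℚ_[p] 1) k n = padicLRiemannSum f α k n := by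
  unfold padicLRiemannSumTame padicLRiemannSum
  refine finsum_congr fun η => Finset.sum_congr rfl fun s _ => ?_
  rw [Fintype.sum_subsingleton _ (1 : ZMod 1), map_one, one_mul, msdMeasureTame_one]

/-- **Anchor**: `padicLCoeffTame f 1 α 1 k = padicLCoeff f α k`. [cite: MazurTateTeitelbaum1986Invent, §I.13 (pp. 18–19)] -/
theorem padicLCoeffTame_one (α : ℚ_[p]) (k : ℕ) :
    padicLCoeffTame f 1 α (1 : DirichletCharacter ℚ_[p] 1) k = padicLCoeff f α k := by
  unfold padicLCoeffTame padicLCoeff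
  congr 1
  funext n
  exact padicLRiemannSumTame_one f α k n

/-- **Anchor**: at `m = 1`, `χ = 1` the tame `p`-adic `L`-function IS `padicLFunction f α` — the SAME Riemann
sums, hence the same normalisation (at `p = 2`: the halved plus symbol over all of `ℤ₂ˣ`, i.e. the integral
plus measure over `1 + 4ℤ₂`, `PAdicLFunctionIntegralityAtTwoProofs` §3). [cite: MazurTateTeitelbaum1986Invent, §I.13 (pp. 18–19)] -/
theorem padicLFunctionTame_one (α : ℚ_[p]) :
    padicLFunctionTame f 1 α (1 : DirichletCharacter ℚ_[p] 1) = padicLFunction f α := by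
  ext k
  rw [coeff_padicLFunctionTame, coeff_padicLFunction, padicLCoeffTame_one]

end Anchor

/-! ### Named facts (to be proved in `PAdicLFunctionTameProofs`) -/

section Facts

variable {N : ℕ} {p : ℕ} [Fact p.Prime]

/-- **Distribution relation in the `p`-direction at tame level `m`** (Mazur–Tate–Teitelbaum §I.10,
Prop. (10.2); from the Hecke relation `a_p [r]⁺ = ∑_{u mod p} [(r + u)/p]⁺ + [p r]⁺` at the good prime
`p`, tree theorem `intCast_mul_ratPlusSymbol`): for `f` a rational normalised newform of level `N` prime
to `p`, `(m, p) = 1`, `a_p(f) = a_p ∈ ℤ` and `α ≠ 0` with `α² − a_p α + p = 0`,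
`∑_{a' ≡ a (mod pⁿ)} μ_{f,α,m}((a' + pⁿ⁺¹ℤ_p) × {b}) = μ_{f,α,m}((a + pⁿℤ_p) × {b})`. TO BE PROVED (as
`msdMeasure_distribution_holds` at `m = 1`); named here, nothing asserted.
[cite: MazurTateTeitelbaum1986Invent, §I.10 Prop. (10.2) (p. 13)] -/
def msdMeasureTame_distribution : Prop :=
  ∀ [NeZero N] {f : CuspForm (Gamma0 N) 2} (_ : IsNewform0 f) (_ : coeffField f = ⊥) (_ : ¬ p ∣ N)
    {m : ℕ} [NeZero m] (_ : m.Coprime p) {ap : ℤ} (_ : cuspCoeff f p = ap) {α : ℚ_[p]} (_ : α ≠ 0)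
    (_ : α ^ 2 - ap * α + p = 0) (n : ℕ) (a : ZMod (p ^ n)) (b : ZMod m),
    ∑ a' ∈ Finset.univ.filter
        (fun a' : ZMod (p ^ (n + 1)) ↦ ZMod.castHom (pow_dvd_pow p n.le_succ) (ZMod (p ^ n)) a' = a),
      msdMeasureTame f m α (n + 1) a' b = msdMeasureTame f m α n a b

/-- **Change of tame level** (the identity behind Matsuno 2000, Lemma 2.2 = Mazur–Swinnerton-Dyer 1974
§8 Lemma 2): for a prime `ℓ ∤ pmN`, pushing the level-`mℓ` measure forward to level `m` over ALL `ℓ`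
classes `b' ↦ b` gives `∑_{b' ↦ b} μ_{f,α,mℓ}(U × {b'}) = a_ℓ·μ_{f,α,m}(U × {b}) − μ_{f,α,m}(ℓU × {ℓb})`
(`U = a + pⁿℤ_p`, `ℓU = ℓa + pⁿℤ_p`; the Hecke relation at the good prime `ℓ`, tree theorem
`intCast_mul_ratPlusSymbol` with `p := ℓ`, at `r = c/(pⁿm)` and `r = c/(pⁿ⁻¹m)`). Matsuno's printed form
sums over the `ℓ − 1` UNIT classes and so carries the third term `− μ_{f,α,m}(ℓ⁻¹U × {ℓ⁻¹b})` (the class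
`b' ≡ 0 (mod ℓ)`); the two forms are equivalent. TO BE PROVED (prototype kernel-checked over the explicit
lifts `b'_u = c + pⁿmu`); named here, nothing asserted.
[cite: Matsuno2000, Lemma 2.2 (p. 85)] [cite: MazurSwinnertonDyer1974Invent, §8 Lemma 2] -/
def msdMeasureTame_levelChange : Prop :=
  ∀ [NeZero N] {f : CuspForm (Gamma0 N) 2} (_ : IsNewform0 f) (_ : coeffField f = ⊥) {m ℓ : ℕ}
    [NeZero m] [NeZero (m * ℓ)] (_ : ℓ.Prime) (_ : ¬ ℓ ∣ N) (_ : ℓ.Coprime (p * m)) (_ : m.Coprime p)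
    {aℓ : ℤ} (_ : cuspCoeff f ℓ = aℓ) (α : ℚ_[p]) (n : ℕ) (a : ZMod (p ^ n)) (b : ZMod m),
    ∑ b' ∈ Finset.univ.filter (fun b' : ZMod (m * ℓ) ↦ ZMod.castHom (dvd_mul_right m ℓ) (ZMod m) b' = b),
        msdMeasureTame f (m * ℓ) α n a b' =
      (aℓ : ℚ_[p]) * msdMeasureTame f m α n a b -
        msdMeasureTame f m α n (a * (ℓ : ZMod (p ^ n))) (b * (ℓ : ZMod m))

/-- **The tame measure is a measure for a unit root**: for `f` a rational normalised newform of level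
prime to `p`, `(m, p) = 1`, `α` the unit root of `X² − a_p X + p` (`‖α‖ = 1`), and every `χ` mod `m` with
values in `ℚ_p`, the Riemann sums converge to the coefficient (the symbols `[c/(pⁿm)]⁺` have bounded
denominators — Manin–Drinfeld, `exists_forall_ratPlusSymbol_eq_div` — and `‖α⁻¹‖ = 1`, `‖χ(b)‖ ≤ 1`), as
`tendsto_padicLRiemannSum` at `m = 1`. TO BE PROVED; named here, nothing asserted.
[cite: MazurTateTeitelbaum1986Invent, §I.11–I.13 (pp. 13–19)] -/
def tendsto_padicLRiemannSumTame : Prop :=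
  ∀ [NeZero N] {f : CuspForm (Gamma0 N) 2} (_ : IsNewform0 f) (_ : coeffField f = ⊥) (_ : ¬ p ∣ N)
    {m : ℕ} [NeZero m] (_ : m.Coprime p) {ap : ℤ} (_ : cuspCoeff f p = ap) {α : ℚ_[p]}
    (_ : α ^ 2 - ap * α + p = 0) (_ : ‖α‖ = 1) (χ : DirichletCharacter ℚ_[p] m) (k : ℕ),
    Tendsto (padicLRiemannSumTame f m α χ k) atTop (𝓝 (padicLCoeffTame f m α χ k))

end Facts

end Literature.NumberTheory.EllipticCurves

end
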